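import Summits.NavierStokesRegularity.NavierStokesRegularity.Theses.OddMorawetz
import Summits.NavierStokesRegularity.NavierStokesRegularity.Theorems.OddMorawetzMorawetzKillsTypeIEvenParity
import Summits.NavierStokesRegularity.NavierStokesRegularity.Theorems.OddMorawetzMorawetzKillsTypeIWeightOneGlue
import Summits.NavierStokesRegularity.NavierStokesRegularity.Theorems.OddMorawetzMorawetzKillsTypeIRotateEulerBilinear
import Summits.NavierStokesRegularity.NavierStokesRegularity.Theorems.OddMorawetzMorawetzKillsTypeIWeightOneStructure
import Summits.NavierStokesRegularity.NavierStokesRegularity.Theorems.OddMorawetzMorawetzKillsTypeIDivFreeEulerBilinear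
import Summits.NavierStokesRegularity.NavierStokesRegularity.Theorems.OddMorawetzMorawetzKillsTypeIWeightOneAverage
import Summits.NavierStokesRegularity.NavierStokesRegularity.Theorems.OddMorawetzMorawetzKillsTypeIWeightOneNullLagrangian
import HarnessLib

/-!
# Route OddMorawetz — `MorawetzKillsTypeI`: reduction of the bridge to the absence of certificates at weights 3 and 5

(crux item `stmt-NavierStokesRegularity-1377`, line `birth`; lands `--supports` the crux.)

The crux `MorawetzKillsTypeI` is a `∀ (k, m)`-bridge: every admissible local density of derivative weight `k ≤ 5`
carrying a MORAWETZ CERTIFICATE (`Q_m ≥ 0` on divergence-free Schwartz fields, `> 0` once) excludes Type-I blow-up.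
This file records what the line has reduced it to.

* `no_morawetzCertificate_of_weight_one` — there is NO certificate of weight `k = 1` (hyperoctahedral averaging:
  the registered glue `stub_weightOne_glue` fed with its five landed ingredient stubs; hypothesis-free).
* `three_le_of_morawetzCertificate` — hence (with the parity theorem `no_morawetzCertificate_of_even`) a certificate
  has ODD weight `k ≥ 3`; under the crux's bound `k ≤ 5` this means `k ∈ {3, 5}`.
* `morawetzKillsTypeI_of_no_certificate_ge_three` — CONSEQUENTLY the crux follows from the absence of certificates at
  odd weights `3 ≤ k ≤ 5` alone (no Type-I / Liouville input whatsoever): the bridge is vacuous there. This is the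
  registered sub-goal of the line; the remaining content of the crux is exactly the negative hunt at `k = 3, 5`
  (the refutation side of the sibling crux `OddMorawetzLocal`, stmt-NavierStokesRegularity-1376, whose line lead has
  landed the `B₃`-normal form `oddMorawetzLocal_iff_odd_b3Invariant`).
* `morawetzKillsTypeI_of_not_oddMorawetzLocal` — in particular `¬ OddMorawetzLocal → MorawetzKillsTypeI` (the two
  cruxes share their certificate clauses verbatim).
-/

noncomputable section

-- the route's Theorems namespace repeats the summit name by design (Summit.<S>.<P>.Theorems, S = P)
set_option linter.dupNamespace false

namespace Summit.NavierStokesRegularity.NavierStokesRegularity.Theorems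

open MeasureTheory

/-- **No Morawetz certificate of derivative weight one** (hypothesis-free form of the registered glue
`stub_weightOne_glue`, fed with the landed ingredient stubs `stub_rotate_eulerBilinear`, `stub_weightOne_structure`,
`stub_divFree_eulerBilinear`, `stub_weightOne_average`, `stub_weightOne_nullLagrangian`): for `k = 1` the certificate
clauses of the cruxes (with their own `let J` / `let Q`) are contradictory. -/
theorem no_morawetzCertificate_of_weight_one :
    ∀ (k : ℕ) (m : EuclideanSpace ℝ (Fin 3) × (EuclideanSpace ℝ (Fin 3) [×1]→L[ℝ] EuclideanSpace ℝ (Fin 3)) × (EuclideanSpace ℝ (Fin 3) [×2]→L[ℝ] EuclideanSpace ℝ (Fin 3)) × (EuclideanSpace ℝ (Fin 3) [×3]→L[ℝ] EuclideanSpace ℝ (Fin 3)) → ℝ),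
      let J := fun (v : EuclideanSpace ℝ (Fin 3) → EuclideanSpace ℝ (Fin 3)) (x : EuclideanSpace ℝ (Fin 3)) =>
        (v x, iteratedFDeriv ℝ 1 v x, iteratedFDeriv ℝ 2 v x, iteratedFDeriv ℝ 3 v x);
      let Q := fun (v : EuclideanSpace ℝ (Fin 3) → EuclideanSpace ℝ (Fin 3)) =>
        -∫ x, fderiv ℝ m (J v x) (J (Literature.Analysis.FluidPDE.eulerBilinear v v) x);
      k = 1 → ContDiff ℝ (⊤ : ℕ∞) m → (∀ (μ : ℝ) z, m (μ • z) = μ ^ 3 * m z) →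
      (∀ (s : ℝ), 0 < s → ∀ (z₀ : EuclideanSpace ℝ (Fin 3))
          (z₁ : EuclideanSpace ℝ (Fin 3) [×1]→L[ℝ] EuclideanSpace ℝ (Fin 3))
          (z₂ : EuclideanSpace ℝ (Fin 3) [×2]→L[ℝ] EuclideanSpace ℝ (Fin 3))
          (z₃ : EuclideanSpace ℝ (Fin 3) [×3]→L[ℝ] EuclideanSpace ℝ (Fin 3)),
          m (z₀, s • z₁, (s ^ 2) • z₂, (s ^ 3) • z₃) = s ^ k * m (z₀, z₁, z₂, z₃)) →
      (∀ v, Literature.Analysis.FluidPDE.IsSchwartzField v →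
          Literature.Analysis.FluidPDE.VectorCalculus.IsDivFree v → 0 ≤ Q v) →
      (∃ v, Literature.Analysis.FluidPDE.IsSchwartzField v ∧
          Literature.Analysis.FluidPDE.VectorCalculus.IsDivFree v ∧ 0 < Q v) → False :=
  stub_weightOne_glue stub_rotate_eulerBilinear stub_weightOne_structure stub_divFree_eulerBilinear
    stub_weightOne_average stub_weightOne_nullLagrangian

/-- **A Morawetz certificate has odd derivative weight at least three**: the certificate clauses force `Odd k`
(`no_morawetzCertificate_of_even`) and `k ≠ 1` (`no_morawetzCertificate_of_weight_one`), hence `3 ≤ k`. -/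
theorem three_le_of_morawetzCertificate :
    ∀ (k : ℕ) (m : EuclideanSpace ℝ (Fin 3) × (EuclideanSpace ℝ (Fin 3) [×1]→L[ℝ] EuclideanSpace ℝ (Fin 3)) × (EuclideanSpace ℝ (Fin 3) [×2]→L[ℝ] EuclideanSpace ℝ (Fin 3)) × (EuclideanSpace ℝ (Fin 3) [×3]→L[ℝ] EuclideanSpace ℝ (Fin 3)) → ℝ),
      let J := fun (v : EuclideanSpace ℝ (Fin 3) → EuclideanSpace ℝ (Fin 3)) (x : EuclideanSpace ℝ (Fin 3)) =>
        (v x, iteratedFDeriv ℝ 1 v x, iteratedFDeriv ℝ 2 v x, iteratedFDeriv ℝ 3 v x);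
      let Q := fun (v : EuclideanSpace ℝ (Fin 3) → EuclideanSpace ℝ (Fin 3)) =>
        -∫ x, fderiv ℝ m (J v x) (J (Literature.Analysis.FluidPDE.eulerBilinear v v) x);
      ContDiff ℝ (⊤ : ℕ∞) m → (∀ (μ : ℝ) z, m (μ • z) = μ ^ 3 * m z) →
      (∀ (s : ℝ), 0 < s → ∀ (z₀ : EuclideanSpace ℝ (Fin 3))
          (z₁ : EuclideanSpace ℝ (Fin 3) [×1]→L[ℝ] EuclideanSpace ℝ (Fin 3))
          (z₂ : EuclideanSpace ℝ (Fin 3) [×2]→L[ℝ] EuclideanSpace ℝ (Fin 3))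
          (z₃ : EuclideanSpace ℝ (Fin 3) [×3]→L[ℝ] EuclideanSpace ℝ (Fin 3)),
          m (z₀, s • z₁, (s ^ 2) • z₂, (s ^ 3) • z₃) = s ^ k * m (z₀, z₁, z₂, z₃)) →
      (∀ v, Literature.Analysis.FluidPDE.IsSchwartzField v →
          Literature.Analysis.FluidPDE.VectorCalculus.IsDivFree v → 0 ≤ Q v) →
      (∃ v, Literature.Analysis.FluidPDE.IsSchwartzField v ∧
          Literature.Analysis.FluidPDE.VectorCalculus.IsDivFree v ∧ 0 < Q v) → Odd k ∧ 3 ≤ k := by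
  intro k m J Q hsm hhom hwt hQ hpos
  rcases Nat.even_or_odd k with hke | hko
  · exact (no_morawetzCertificate_of_even k m hke hsm hhom hwt hQ hpos).elim
  · refine ⟨hko, ?_⟩
    by_contra hlt
    have hk1 : k = 1 := by
      obtain ⟨r, hr⟩ := hko
      omega
    exact no_morawetzCertificate_of_weight_one k m hk1 hsm hhom hwt hQ hpos

/-- **The bridge is vacuous away from weights 3 and 5** (registered sub-goal of the line): if NO admissible density of
ODD derivative weight `3 ≤ k ≤ 5` carries a Morawetz certificate, then `MorawetzKillsTypeI` holds — every other weight
is already certificate-free (`three_le_of_morawetzCertificate`), so the crux's hypotheses are never met. No Type-I,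
zoom, capture or Liouville input is used: what is left of the crux is the negative hunt at `k = 3, 5`. -/
theorem morawetzKillsTypeI_of_no_certificate_ge_three :
    (∀ (k : ℕ) (m : EuclideanSpace ℝ (Fin 3) × (EuclideanSpace ℝ (Fin 3) [×1]→L[ℝ] EuclideanSpace ℝ (Fin 3)) × (EuclideanSpace ℝ (Fin 3) [×2]→L[ℝ] EuclideanSpace ℝ (Fin 3)) × (EuclideanSpace ℝ (Fin 3) [×3]→L[ℝ] EuclideanSpace ℝ (Fin 3)) → ℝ),
      let J := fun (v : EuclideanSpace ℝ (Fin 3) → EuclideanSpace ℝ (Fin 3)) (x : EuclideanSpace ℝ (Fin 3)) =>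
        (v x, iteratedFDeriv ℝ 1 v x, iteratedFDeriv ℝ 2 v x, iteratedFDeriv ℝ 3 v x);
      let Q := fun (v : EuclideanSpace ℝ (Fin 3) → EuclideanSpace ℝ (Fin 3)) =>
        -∫ x, fderiv ℝ m (J v x) (J (Literature.Analysis.FluidPDE.eulerBilinear v v) x);
      3 ≤ k → k ≤ 5 → Odd k → ContDiff ℝ (⊤ : ℕ∞) m → (∀ (μ : ℝ) z, m (μ • z) = μ ^ 3 * m z) →
      (∀ (s : ℝ), 0 < s → ∀ (z₀ : EuclideanSpace ℝ (Fin 3))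
          (z₁ : EuclideanSpace ℝ (Fin 3) [×1]→L[ℝ] EuclideanSpace ℝ (Fin 3))
          (z₂ : EuclideanSpace ℝ (Fin 3) [×2]→L[ℝ] EuclideanSpace ℝ (Fin 3))
          (z₃ : EuclideanSpace ℝ (Fin 3) [×3]→L[ℝ] EuclideanSpace ℝ (Fin 3)),
          m (z₀, s • z₁, (s ^ 2) • z₂, (s ^ 3) • z₃) = s ^ k * m (z₀, z₁, z₂, z₃)) →
      (∀ v, Literature.Analysis.FluidPDE.IsSchwartzField v →
          Literature.Analysis.FluidPDE.VectorCalculus.IsDivFree v → 0 ≤ Q v) →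
      (∃ v, Literature.Analysis.FluidPDE.IsSchwartzField v ∧
          Literature.Analysis.FluidPDE.VectorCalculus.IsDivFree v ∧ 0 < Q v) → False) →
    Theses.OddMorawetz.MorawetzKillsTypeI := by
  intro h k m J Q hk hsm hhom hwt hQ hpos ν T hν hT u p hcl hLH hdec hI
  obtain ⟨hko, h3⟩ := three_le_of_morawetzCertificate k m hsm hhom hwt hQ hpos
  exact (h k m h3 hk hko hsm hhom hwt hQ hpos).elim

/-- **`¬ OddMorawetzLocal → MorawetzKillsTypeI`**: the hunt and the bridge share their certificate clauses verbatim,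
so a negative hunt closes the bridge vacuously (route kill criterion (i) makes the bridge moot but TRUE). -/
theorem morawetzKillsTypeI_of_not_oddMorawetzLocal
    (h : ¬ Theses.OddMorawetz.OddMorawetzLocal) : Theses.OddMorawetz.MorawetzKillsTypeI := by
  intro k m J Q hk hsm hhom hwt hQ hpos ν T hν hT u p hcl hLH hdec hI
  exact (h ⟨k, m, hk, hsm, hhom, hwt, hQ, hpos⟩).elim

end Summit.NavierStokesRegularity.NavierStokesRegularity.Theorems

end
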